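import Summits.Ventures.PercRepro.S2MultWeightSums
import Summits.Ventures.PercRepro.S2MultWeightSumsB

/-!
# PercRepro — THE WEIGHT CERTIFICATE OF THE THEOREM-M STAIRCASE KEY: THE ARITHMETIC (p4, S4 feed)

`proofs/P4-gen18.md`. THEOREM M (S2IndepCount, `card_spanF_ge_indep`) gives every rank-`q` set of nullity `ν` the
multiplicity `L_{j₀}(ν) = j₀·(C(ν, j₀) − (2^{j₀−1} − j₀)·C(ν, j₀ − 1))` for EVERY `j₀`; the staircase
`mult(ν) = max(quart(ν), max_{3 ≤ j₀ ≤ 12} L_{j₀}(ν))` is the multiplicity of the key `KeyL`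
(RankLevelSetExplicitLin2KeyL). Its class weight `W(μ) = Σ_{j < N} C(μ − 1, j)/mult(j + 1)` is certified in the integer
form `W·D ≤ c·2^μ` the generic key `KeyG` takes, from four Mathlib-only facts proved here:
* `mul_choose_le_mul_indepBound`: `b·j₀·C(ν, j₀) ≤ a·L_{j₀}(ν)` as soon as `a·c₀·j₀ + b·(ν + 1 − j₀) ≤ a·(ν + 1 − j₀)`
  (`c₀ = 2^{j₀−1} − j₀`; the general ratio `a/b` in place of the `2` of `mul_choose_le_two_mul_indepBound`);
* `pow_mul_sum_range_choose_le_add_pow`: the Chernoff trick `a^{n−K}·b^K·Σ_{i ≤ K} C(n, i) ≤ (a + b)^n` for `b ≤ a`;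
* `sum_range_choose_div_quart_le_chernoff`: the HEAD `Σ_{j < J} C(F, j)/quart(j + 1) ≤ 8^{F+4}/(5^{F+1−J}·3^{J+3}·C(F + 4, 4))`
  (`quart(j + 1) ≥ C(j + 4, 4)`, Pascal's `C(F, j)/C(j + 4, 4) = C(F + 4, j + 4)/C(F + 4, 4)`, Chernoff with `(5, 3)`);
* `sum_Ico_choose_div_indepBound_le`: the TAIL `Σ_{J ≤ j < N} C(F, j)/L_{j₀}(j + 1) ≤ (a/(b·j₀))·ρ(J)·2^{F+j₀}/C(F + j₀, j₀)`,
  `ρ(J) = C(J + j₀, j₀)/C(J + 1, j₀)` (the ratio lemma at `ν = j + 1 ≥ J + 1` and `sum_Ico_choose_div_choose_succ_le`);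
and `sum_range_choose_div_mult_le_head_add_tail` puts them together for any `mult ≥ quart`, `mult ≥ L_{j₀}`. Axioms: standard.
-/

namespace PercRepro

namespace S2

/-- **THE GENERAL-RATIO FORM OF THE INDEP BOUND**: `b·(j₀·C(ν, j₀)) ≤ a·L_{j₀}(ν)` as soon as
`a·(c₀·j₀) + b·(ν + 1 − j₀) ≤ a·(ν + 1 − j₀)` with `c₀ = 2^{j₀−1} − j₀` (i.e. `(a − b)(ν + 1 − j₀) ≥ a·c₀·j₀`:
the ratio `a/b` is `1/(1 − c₀j₀/(ν + 1 − j₀))`, the exact ratio `j₀·C(ν, j₀)/L_{j₀}(ν)`). The case `a = 2`, `b = 1` is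
`mul_choose_le_two_mul_indepBound`. -/
theorem mul_choose_le_mul_indepBound (ν j₀ a b : ℕ) (hj : 1 ≤ j₀)
    (hν : a * ((2 ^ (j₀ - 1) - j₀) * j₀) + b * (ν + 1 - j₀) ≤ a * (ν + 1 - j₀)) :
    b * (j₀ * ν.choose j₀) ≤ a * (j₀ * (ν.choose j₀ - (2 ^ (j₀ - 1) - j₀) * ν.choose (j₀ - 1))) := by
  set c := 2 ^ (j₀ - 1) - j₀ with hc
  -- `C(ν, j₀)·j₀ = C(ν, j₀ − 1)·(ν + 1 − j₀)`
  have e := Nat.choose_succ_right_eq ν (j₀ - 1)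
  rw [show j₀ - 1 + 1 = j₀ by omega, show ν - (j₀ - 1) = ν + 1 - j₀ by omega] at e
  have e2 : (ν + 1 - j₀) * ν.choose (j₀ - 1) = j₀ * ν.choose j₀ := by
    rw [mul_comm, ← e]; ring
  have h := Nat.mul_le_mul_right (ν.choose (j₀ - 1)) hν
  have h2 : a * (c * j₀) * ν.choose (j₀ - 1) + b * (j₀ * ν.choose j₀) ≤ a * (j₀ * ν.choose j₀) := by
    calc a * (c * j₀) * ν.choose (j₀ - 1) + b * (j₀ * ν.choose j₀)
        = a * (c * j₀) * ν.choose (j₀ - 1) + b * ((ν + 1 - j₀) * ν.choose (j₀ - 1)) := by rw [e2]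
      _ = (a * (c * j₀) + b * (ν + 1 - j₀)) * ν.choose (j₀ - 1) := by ring
      _ ≤ a * (ν + 1 - j₀) * ν.choose (j₀ - 1) := h
      _ = a * ((ν + 1 - j₀) * ν.choose (j₀ - 1)) := by ring
      _ = a * (j₀ * ν.choose j₀) := by rw [e2]
  have h3 : a * (j₀ * (ν.choose j₀ - c * ν.choose (j₀ - 1))) =
      a * (j₀ * ν.choose j₀) - a * (c * j₀) * ν.choose (j₀ - 1) := by
    rw [Nat.mul_sub, Nat.mul_sub]
    congr 1
    ring
  rw [h3]
  apply Nat.le_sub_of_add_le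
  linarith [h2]

/-- **THE CHERNOFF TRICK**: `a^{n−K}·b^K·Σ_{i ≤ K} C(n, i) ≤ (a + b)^n` for `b ≤ a`, `K ≤ n` (every term of the left
side is dominated by its term `b^i·a^{n−i}·C(n, i)` of the binomial theorem, as `b^{K−i} ≤ a^{K−i}`). -/
theorem pow_mul_sum_range_choose_le_add_pow (a b n K : ℕ) (hab : b ≤ a) (hK : K ≤ n) :
    a ^ (n - K) * b ^ K * ∑ i ∈ Finset.range (K + 1), n.choose i ≤ (a + b) ^ n := by
  have hterm : ∀ i ∈ Finset.range (K + 1),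
      a ^ (n - K) * b ^ K * n.choose i ≤ b ^ i * a ^ (n - i) * n.choose i := by
    intro i hi
    rw [Finset.mem_range] at hi
    apply Nat.mul_le_mul_right
    have e1 : b ^ K = b ^ i * b ^ (K - i) := by rw [← pow_add]; congr 1; omega
    have e2 : a ^ (n - i) = a ^ (n - K) * a ^ (K - i) := by rw [← pow_add]; congr 1; omega
    rw [e1, e2]
    calc a ^ (n - K) * (b ^ i * b ^ (K - i)) = b ^ i * (a ^ (n - K) * b ^ (K - i)) := by ring
      _ ≤ b ^ i * (a ^ (n - K) * a ^ (K - i)) :=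
          Nat.mul_le_mul_left _ (Nat.mul_le_mul_left _ (Nat.pow_le_pow_left hab _))
  calc a ^ (n - K) * b ^ K * ∑ i ∈ Finset.range (K + 1), n.choose i
      = ∑ i ∈ Finset.range (K + 1), a ^ (n - K) * b ^ K * n.choose i := by rw [Finset.mul_sum]
    _ ≤ ∑ i ∈ Finset.range (K + 1), b ^ i * a ^ (n - i) * n.choose i := Finset.sum_le_sum hterm
    _ ≤ ∑ i ∈ Finset.range (n + 1), b ^ i * a ^ (n - i) * n.choose i :=
        Finset.sum_le_sum_of_subset_of_nonneg (Finset.range_mono (by omega)) (fun _ _ _ => Nat.zero_le _)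
    _ = (b + a) ^ n := (add_pow b a n).symm
    _ = (a + b) ^ n := by rw [add_comm]

/-- `Σ_{j < J} C(n, j + 4) ≤ Σ_{i ≤ J + 3} C(n, i)`. -/
theorem sum_range_choose_add_four_le (n J : ℕ) :
    ∑ j ∈ Finset.range J, n.choose (j + 4) ≤ ∑ i ∈ Finset.range (J + 3 + 1), n.choose i := by
  have h1 : ∑ j ∈ Finset.range J, n.choose (j + 4) = ∑ i ∈ Finset.Ico 4 (J + 4), n.choose i := by
    rw [Finset.sum_Ico_eq_sum_range, show J + 4 - 4 = J by omega]
    apply Finset.sum_congr rfl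
    intro j _
    rw [add_comm 4 j]
  rw [h1]
  apply Finset.sum_le_sum_of_subset_of_nonneg _ (fun _ _ _ => Nat.zero_le _)
  intro i hi
  rw [Finset.mem_Ico] at hi
  rw [Finset.mem_range]
  omega

/-- **THE HEAD OF THE WEIGHT**: `Σ_{j < J} C(F, j)/quart(j + 1) ≤ 8^{F+4}/(5^{F+1−J}·3^{J+3}·C(F + 4, 4))` for `J ≤ F + 1`
(`quart(j + 1) ≥ C(j + 4, 4)`, Pascal's `C(F, j)/C(j + 4, 4) = C(F + 4, j + 4)/C(F + 4, 4)`, then the partial binomial sum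
up to `J + 3` by the Chernoff trick with `(a, b) = (5, 3)`). -/
theorem sum_range_choose_div_quart_le_chernoff (F J : ℕ) (hJ : J ≤ F + 1) :
    ∑ j ∈ Finset.range J, (F.choose j : ℚ) /
        (((j + 1) + 3 * (j + 1).choose 2 + 3 * (j + 1).choose 3 + 2 * (j + 1).choose 4 : ℕ) : ℚ) ≤
      (8 : ℚ) ^ (F + 4) / ((5 : ℚ) ^ (F + 1 - J) * (3 : ℚ) ^ (J + 3) * ((F + 4).choose 4 : ℚ)) := by
  have hC4 : (0 : ℚ) < ((F + 4).choose 4 : ℚ) := by exact_mod_cast Nat.choose_pos (by omega : 4 ≤ F + 4)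
  -- termwise: `C(F, j)/quart(j + 1) ≤ C(F, j)/C(j + 4, 4) = C(F + 4, j + 4)/C(F + 4, 4)`
  have hterm : ∀ j ∈ Finset.range J, (F.choose j : ℚ) /
      (((j + 1) + 3 * (j + 1).choose 2 + 3 * (j + 1).choose 3 + 2 * (j + 1).choose 4 : ℕ) : ℚ) ≤
      ((F + 4).choose (j + 4) : ℚ) / ((F + 4).choose 4 : ℚ) := by
    intro j _
    have hq : (0 : ℚ) < ((j + 4).choose 4 : ℚ) := by exact_mod_cast Nat.choose_pos (by omega : 4 ≤ j + 4)
    have hle : ((j + 4).choose 4 : ℚ) ≤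
        (((j + 1) + 3 * (j + 1).choose 2 + 3 * (j + 1).choose 3 + 2 * (j + 1).choose 4 : ℕ) : ℚ) := by
      exact_mod_cast choose_add_four_le_quart j
    calc (F.choose j : ℚ) /
          (((j + 1) + 3 * (j + 1).choose 2 + 3 * (j + 1).choose 3 + 2 * (j + 1).choose 4 : ℕ) : ℚ)
        ≤ (F.choose j : ℚ) / ((j + 4).choose 4 : ℚ) :=
          div_le_div_of_nonneg_left (Nat.cast_nonneg _) hq hle
      _ = ((F + 4).choose (j + 4) : ℚ) / ((F + 4).choose 4 : ℚ) := by
          rw [div_eq_div_iff hq.ne' hC4.ne']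
          exact_mod_cast choose_mul_choose_add F j 4
  -- the partial binomial sum by the Chernoff trick
  have hch := pow_mul_sum_range_choose_le_add_pow 5 3 (F + 4) (J + 3) (by norm_num) (by omega)
  rw [show F + 4 - (J + 3) = F + 1 - J by omega] at hch
  have hsum := sum_range_choose_add_four_le (F + 4) J
  have hP : (0 : ℚ) < (5 : ℚ) ^ (F + 1 - J) * (3 : ℚ) ^ (J + 3) := by positivity
  have hch' : ((5 : ℚ) ^ (F + 1 - J) * (3 : ℚ) ^ (J + 3)) *
      ∑ i ∈ Finset.range (J + 3 + 1), ((F + 4).choose i : ℚ) ≤ (8 : ℚ) ^ (F + 4) := by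
    norm_num at hch
    exact_mod_cast hch
  have hsum' : ∑ j ∈ Finset.range J, ((F + 4).choose (j + 4) : ℚ) ≤
      ∑ i ∈ Finset.range (J + 3 + 1), ((F + 4).choose i : ℚ) := by exact_mod_cast hsum
  have hS0 : (0 : ℚ) ≤ ∑ i ∈ Finset.range (J + 3 + 1), ((F + 4).choose i : ℚ) :=
    Finset.sum_nonneg (fun _ _ => Nat.cast_nonneg _)
  calc ∑ j ∈ Finset.range J, (F.choose j : ℚ) /
          (((j + 1) + 3 * (j + 1).choose 2 + 3 * (j + 1).choose 3 + 2 * (j + 1).choose 4 : ℕ) : ℚ)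
      ≤ ∑ j ∈ Finset.range J, ((F + 4).choose (j + 4) : ℚ) / ((F + 4).choose 4 : ℚ) := Finset.sum_le_sum hterm
    _ = (∑ j ∈ Finset.range J, ((F + 4).choose (j + 4) : ℚ)) / ((F + 4).choose 4 : ℚ) := by
        rw [Finset.sum_div]
    _ ≤ (∑ i ∈ Finset.range (J + 3 + 1), ((F + 4).choose i : ℚ)) / ((F + 4).choose 4 : ℚ) := by
        gcongr
    _ ≤ (8 : ℚ) ^ (F + 4) / ((5 : ℚ) ^ (F + 1 - J) * (3 : ℚ) ^ (J + 3) * ((F + 4).choose 4 : ℚ)) := by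
        rw [div_le_div_iff₀ hC4 (mul_pos hP hC4)]
        calc (∑ i ∈ Finset.range (J + 3 + 1), ((F + 4).choose i : ℚ)) *
              ((5 : ℚ) ^ (F + 1 - J) * (3 : ℚ) ^ (J + 3) * ((F + 4).choose 4 : ℚ))
            = (((5 : ℚ) ^ (F + 1 - J) * (3 : ℚ) ^ (J + 3)) *
                ∑ i ∈ Finset.range (J + 3 + 1), ((F + 4).choose i : ℚ)) * ((F + 4).choose 4 : ℚ) := by ring
          _ ≤ (8 : ℚ) ^ (F + 4) * ((F + 4).choose 4 : ℚ) := by gcongr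

/-- The ratio condition propagates from `ν = J + 1` to every `ν = j + 1 ≥ J + 1` (`b ≤ a` there). -/
theorem ratio_cond_mono (J j j₀ a b : ℕ) (hJ : j₀ ≤ J + 1) (hj : J ≤ j)
    (hab : a * ((2 ^ (j₀ - 1) - j₀) * j₀) + b * (J + 2 - j₀) ≤ a * (J + 2 - j₀)) :
    a * ((2 ^ (j₀ - 1) - j₀) * j₀) + b * (j + 1 + 1 - j₀) ≤ a * (j + 1 + 1 - j₀) := by
  have hba : b ≤ a := by
    have h1 : b * (J + 2 - j₀) ≤ a * (J + 2 - j₀) := le_trans (Nat.le_add_left _ _) hab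
    exact Nat.le_of_mul_le_mul_right h1 (by omega)
  have hsplit : j + 1 + 1 - j₀ = (J + 2 - j₀) + (j - J) := by omega
  rw [hsplit, Nat.mul_add, Nat.mul_add]
  have := Nat.mul_le_mul_right (j - J) hba
  linarith

/-- Under the ratio condition with `1 ≤ b` and `j₀ ≤ ν`, the indep bound is positive. -/
theorem indepBound_pos (ν j₀ a b : ℕ) (hj : 1 ≤ j₀) (hjν : j₀ ≤ ν) (hb : 1 ≤ b)
    (hν : a * ((2 ^ (j₀ - 1) - j₀) * j₀) + b * (ν + 1 - j₀) ≤ a * (ν + 1 - j₀)) :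
    0 < (j₀ * (ν.choose j₀ - (2 ^ (j₀ - 1) - j₀) * ν.choose (j₀ - 1))) := by
  have h := mul_choose_le_mul_indepBound ν j₀ a b hj hν
  have hC : 0 < ν.choose j₀ := Nat.choose_pos hjν
  have hpos : 0 < b * (j₀ * ν.choose j₀) := by positivity
  have : 0 < a * (j₀ * (ν.choose j₀ - (2 ^ (j₀ - 1) - j₀) * ν.choose (j₀ - 1))) := lt_of_lt_of_le hpos h
  exact Nat.pos_of_mul_pos_left this

/-- **THE TAIL OF THE WEIGHT**: for `1 ≤ j₀ ≤ J + 1`, `1 ≤ b` and the ratio condition at `ν = J + 1`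
(`a·(c₀·j₀) + b·(J + 2 − j₀) ≤ a·(J + 2 − j₀)`):
`Σ_{J ≤ j < N} C(F, j)/L_{j₀}(j + 1) ≤ (a/(b·j₀))·(C(J + j₀, j₀)/C(J + 1, j₀))·(2^{F+j₀}/C(F + j₀, j₀))`
(`b·j₀·C(j + 1, j₀) ≤ a·L_{j₀}(j + 1)` termwise, then `sum_Ico_choose_div_choose_succ_le`). -/
theorem sum_Ico_choose_div_indepBound_le (F N J j₀ a b : ℕ) (hj : 1 ≤ j₀) (hJ : j₀ ≤ J + 1) (hb : 1 ≤ b)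
    (hab : a * ((2 ^ (j₀ - 1) - j₀) * j₀) + b * (J + 2 - j₀) ≤ a * (J + 2 - j₀)) :
    ∑ j ∈ Finset.Ico J N, (F.choose j : ℚ) / (((j₀ * ((j + 1).choose j₀ - (2 ^ (j₀ - 1) - j₀) * (j + 1).choose (j₀ - 1))) : ℕ) : ℚ) ≤
      ((a : ℚ) / ((b * j₀ : ℕ) : ℚ)) *
        (((((J + j₀).choose j₀ : ℕ) : ℚ) / (((J + 1).choose j₀ : ℕ) : ℚ)) *
          (2 ^ (F + j₀) / (((F + j₀).choose j₀ : ℕ) : ℚ))) := by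
  have hterm : ∀ j ∈ Finset.Ico J N, (F.choose j : ℚ) / (((j₀ * ((j + 1).choose j₀ - (2 ^ (j₀ - 1) - j₀) * (j + 1).choose (j₀ - 1))) : ℕ) : ℚ) ≤
      ((a : ℚ) / ((b * j₀ : ℕ) : ℚ)) * ((F.choose j : ℚ) / (((j + 1).choose j₀ : ℕ) : ℚ)) := by
    intro j hj'
    rw [Finset.mem_Ico] at hj'
    have hcond := ratio_cond_mono J j j₀ a b hJ hj'.1 hab
    have hL := mul_choose_le_mul_indepBound (j + 1) j₀ a b hj hcond
    have hLpos : (0 : ℚ) < (((j₀ * ((j + 1).choose j₀ - (2 ^ (j₀ - 1) - j₀) * (j + 1).choose (j₀ - 1))) : ℕ) : ℚ) := by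
      exact_mod_cast indepBound_pos (j + 1) j₀ a b hj (by omega) hb hcond
    have hCpos : (0 : ℚ) < (((j + 1).choose j₀ : ℕ) : ℚ) := by exact_mod_cast Nat.choose_pos (by omega)
    have hbj : (0 : ℚ) < ((b * j₀ : ℕ) : ℚ) := by exact_mod_cast (by positivity : 0 < b * j₀)
    rw [div_mul_div_comm, div_le_div_iff₀ hLpos (mul_pos hbj hCpos)]
    have hLq : (b : ℚ) * ((j₀ : ℚ) * (((j + 1).choose j₀ : ℕ) : ℚ)) ≤ (a : ℚ) * (((j₀ * ((j + 1).choose j₀ - (2 ^ (j₀ - 1) - j₀) * (j + 1).choose (j₀ - 1))) : ℕ) : ℚ) := by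
      exact_mod_cast hL
    have hF0 : (0 : ℚ) ≤ (F.choose j : ℚ) := Nat.cast_nonneg _
    calc (F.choose j : ℚ) * (((b * j₀ : ℕ) : ℚ) * (((j + 1).choose j₀ : ℕ) : ℚ))
        = (F.choose j : ℚ) * ((b : ℚ) * ((j₀ : ℚ) * (((j + 1).choose j₀ : ℕ) : ℚ))) := by push_cast; ring
      _ ≤ (F.choose j : ℚ) * ((a : ℚ) * (((j₀ * ((j + 1).choose j₀ - (2 ^ (j₀ - 1) - j₀) * (j + 1).choose (j₀ - 1))) : ℕ) : ℚ)) :=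
          mul_le_mul_of_nonneg_left hLq hF0
      _ = (a : ℚ) * (F.choose j : ℚ) * (((j₀ * ((j + 1).choose j₀ - (2 ^ (j₀ - 1) - j₀) * (j + 1).choose (j₀ - 1))) : ℕ) : ℚ) := by ring
  calc ∑ j ∈ Finset.Ico J N, (F.choose j : ℚ) / (((j₀ * ((j + 1).choose j₀ - (2 ^ (j₀ - 1) - j₀) * (j + 1).choose (j₀ - 1))) : ℕ) : ℚ)
      ≤ ∑ j ∈ Finset.Ico J N, ((a : ℚ) / ((b * j₀ : ℕ) : ℚ)) * ((F.choose j : ℚ) / (((j + 1).choose j₀ : ℕ) : ℚ)) :=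
        Finset.sum_le_sum hterm
    _ = ((a : ℚ) / ((b * j₀ : ℕ) : ℚ)) * ∑ j ∈ Finset.Ico J N, (F.choose j : ℚ) / (((j + 1).choose j₀ : ℕ) : ℚ) := by
        rw [Finset.mul_sum]
    _ ≤ ((a : ℚ) / ((b * j₀ : ℕ) : ℚ)) *
        (((((J + j₀).choose j₀ : ℕ) : ℚ) / (((J + 1).choose j₀ : ℕ) : ℚ)) *
          (2 ^ (F + j₀) / (((F + j₀).choose j₀ : ℕ) : ℚ))) := by
        apply mul_le_mul_of_nonneg_left (sum_Ico_choose_div_choose_succ_le F N J j₀ hJ)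
        exact div_nonneg (Nat.cast_nonneg _) (Nat.cast_nonneg _)

/-- `Σ_{j < N} f j ≤ Σ_{j < J} f j + Σ_{J ≤ j < N} f j` for `f ≥ 0`. -/
theorem sum_range_le_sum_range_add_sum_Ico (f : ℕ → ℚ) (hf : ∀ j, 0 ≤ f j) (N J : ℕ) :
    ∑ j ∈ Finset.range N, f j ≤ ∑ j ∈ Finset.range J, f j + ∑ j ∈ Finset.Ico J N, f j := by
  rcases Nat.lt_or_ge N J with h | h
  · rw [Finset.Ico_eq_empty_of_le h.le, Finset.sum_empty, add_zero]
    exact Finset.sum_le_sum_of_subset_of_nonneg (Finset.range_mono h.le) (fun j _ _ => hf j)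
  · rw [Finset.sum_range_add_sum_Ico f h]

/-- **THE WEIGHT OF ANY MULTIPLICITY ABOVE THE QUARTIC AND AN INDEP BOUND IS HEAD + TAIL**: for `mult ≥ quart` and
`mult ≥ L_{j₀}` pointwise, `1 ≤ j₀ ≤ J + 1 ≤ F + 2`, `1 ≤ b` and the ratio condition at `ν = J + 1`:
`Σ_{j < N} C(F, j)/mult(j + 1) ≤ 8^{F+4}/(5^{F+1−J}·3^{J+3}·C(F + 4, 4)) +
  (a/(b·j₀))·(C(J + j₀, j₀)/C(J + 1, j₀))·(2^{F+j₀}/C(F + j₀, j₀))`. -/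
theorem sum_range_choose_div_mult_le_head_add_tail (mult : ℕ → ℕ)
    (hquart : ∀ v, v + 3 * v.choose 2 + 3 * v.choose 3 + 2 * v.choose 4 ≤ mult v)
    (j₀ : ℕ) (hL : ∀ v, (j₀ * (v.choose j₀ - (2 ^ (j₀ - 1) - j₀) * v.choose (j₀ - 1))) ≤ mult v) (F N J a b : ℕ) (hj : 1 ≤ j₀) (hJ : j₀ ≤ J + 1) (hJF : J ≤ F + 1)
    (hb : 1 ≤ b) (hab : a * ((2 ^ (j₀ - 1) - j₀) * j₀) + b * (J + 2 - j₀) ≤ a * (J + 2 - j₀)) :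
    ∑ j ∈ Finset.range N, (F.choose j : ℚ) / ((mult (j + 1) : ℕ) : ℚ) ≤
      (8 : ℚ) ^ (F + 4) / ((5 : ℚ) ^ (F + 1 - J) * (3 : ℚ) ^ (J + 3) * ((F + 4).choose 4 : ℚ)) +
      ((a : ℚ) / ((b * j₀ : ℕ) : ℚ)) *
        (((((J + j₀).choose j₀ : ℕ) : ℚ) / (((J + 1).choose j₀ : ℕ) : ℚ)) *
          (2 ^ (F + j₀) / (((F + j₀).choose j₀ : ℕ) : ℚ))) := by
  have hf0 : ∀ j, (0 : ℚ) ≤ (F.choose j : ℚ) / ((mult (j + 1) : ℕ) : ℚ) :=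
    fun j => div_nonneg (Nat.cast_nonneg _) (Nat.cast_nonneg _)
  refine (sum_range_le_sum_range_add_sum_Ico _ hf0 N J).trans (add_le_add ?_ ?_)
  · -- the head: `1/mult(j + 1) ≤ 1/quart(j + 1)`
    refine (Finset.sum_le_sum (fun j _ => ?_)).trans (sum_range_choose_div_quart_le_chernoff F J hJF)
    have hq : (0 : ℚ) < (((j + 1) + 3 * (j + 1).choose 2 + 3 * (j + 1).choose 3 + 2 * (j + 1).choose 4 : ℕ) : ℚ) := by
      exact_mod_cast (by omega : 0 < (j + 1) + 3 * (j + 1).choose 2 + 3 * (j + 1).choose 3 + 2 * (j + 1).choose 4)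
    have hle : (((j + 1) + 3 * (j + 1).choose 2 + 3 * (j + 1).choose 3 + 2 * (j + 1).choose 4 : ℕ) : ℚ) ≤
        ((mult (j + 1) : ℕ) : ℚ) := by exact_mod_cast hquart (j + 1)
    exact div_le_div_of_nonneg_left (Nat.cast_nonneg _) hq hle
  · -- the tail: `1/mult(j + 1) ≤ 1/L_{j₀}(j + 1)`
    refine (Finset.sum_le_sum (fun j hj' => ?_)).trans (sum_Ico_choose_div_indepBound_le F N J j₀ a b hj hJ hb hab)
    rw [Finset.mem_Ico] at hj'
    have hcond := ratio_cond_mono J j j₀ a b hJ hj'.1 hab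
    have hLpos : (0 : ℚ) < (((j₀ * ((j + 1).choose j₀ - (2 ^ (j₀ - 1) - j₀) * (j + 1).choose (j₀ - 1))) : ℕ) : ℚ) := by
      exact_mod_cast indepBound_pos (j + 1) j₀ a b hj (by omega) hb hcond
    have hle : (((j₀ * ((j + 1).choose j₀ - (2 ^ (j₀ - 1) - j₀) * (j + 1).choose (j₀ - 1))) : ℕ) : ℚ) ≤ ((mult (j + 1) : ℕ) : ℚ) := by exact_mod_cast hL (j + 1)
    exact div_le_div_of_nonneg_left (Nat.cast_nonneg _) hLpos hle

end S2

end PercRepro
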